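import Literature.MathematicalPhysics.QuantumFieldTheory.Balaban1983to89.B3DivergentGraphs

/-!
# `Balaban1983to89.B3Sect3LowestOrderGraphs` — T. Bałaban, *(Higgs)₂,₃ quantum fields in a finite volume. III. Renormalization*,
Commun. Math. Phys. **88** (1983) 411–445 [Balaban1983Higgs3]: the PICTURES (3.6) (p. 435), (3.21) (p. 438) and (3.25) (p. 439) —
the self-energy graphs of lowest order — as graphs of the concrete family `B3Cor23Concrete.Graph`, with their printed degrees

statement-level skeleton of published theorems with citation tags; proofs where landed; nothing here is a claim about the Yang–Mills mass gap

PDF held: `paper:balaban1983-higgs-2-3-quantum-fields-finite-volume` (journal page = PDF page + 410); the three displays read as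
images: `…/b2b-balaban-ref1/pages/1983-cmp88-higgs23-III/1983-cmp88-higgs23-III-p025, p028, p029-x2.png` (pp. 435, 438, 439).
CITATION HEADER (lean-in-tree rule).  lit-balaban TYPED SKELETON (HOME `run/shared/lean/pub/lit-balaban/`), Phase 2, seat p18 (gen 3),
unit `lit-balaban-p18`; SKELETON rows **B3.Eq3.6-3.9** (pictures (3.6)), **B3.Eq3.21-3.24** (pictures (3.21)), **B3.Eq3.25-3.32**
(pictures (3.25)), fold owner r15 (cells so far: «pictures not typed»).  Reading of the pictures: straight line = scalar leg/line
φ′, wavy line = vector leg/line A′, arrowhead = the covariant differentiation D^η_B̃ of the vertex (1.8) (it sits on the first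
φ′-leg, leg 0 of the model), small circle = vertex (1.8)/(1.10), dot = vertex (1.6) (legend (1.17) p. 415).  The model
(`B3Cor23Concrete`, seat p18 gen 1) and its leg counts (`B3DivergentGraphs`, gen 2) are unchanged; the CLASSIFICATION theorems
saying that these pictures exhaust the graphs of degree −d + 2 = −1 (d = 3) of their classes are in the sibling modules
`…B3Sect3ScalarSEDegrees` / `…B3Sect3DivergentClasses` (via the degree formula of `…B3Sect3DegreeCensus`).

WHAT THIS MODULE CONTAINS (sorry-free; ten `def`s = ten graphs of the model, no `Prop` fact introduced).  (3.6): `g36a` (= the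
graph (3.8): two vertices (1.8)_{1,0}, the φ′-line through both differentiations, the A′-line), `g36b` (A′-tadpole at (1.10)_{2,0}),
`g36c` (φ′-tadpole at (1.6)) — each with two external φ′-legs only (`g36_legs`) and **D = −d + 2 in every dimension d**
(`g36a_deg`, `g36b_deg`, `g36c_deg`), the printed tag *"(D = −d + 2)"*.  (3.21): `g321a` (A′-tadpole at (1.8)_{2,0}, the
differentiated φ′-leg external), `g321b` (two (1.8)_{1,0}, A′-line, one φ′-line carrying one differentiation) — two external
φ′-legs, one external differentiation (`g321_legs`), D = 3 − d (`g321a_deg`, `g321b_deg`; = 0 in d = 3, the class of p. 438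
*"degrees equal to 0"*); and `g321Y`, a THIRD graph of the model with the same external structure and the same degree (the
φ′-line of `g321b` returning to its own vertex) — the print says *"There are only two such graphs"*: READING NOTE HOME/GAPS.md
G-B3-05 (its closed scalar loop carries one power of q; cf. p. 434 and p. 442 on (2.21a)).  (3.25): `g325a`, `g325b` (two
(1.8)_{1,0} joined by both φ′-lines, the two placements of the differentiations), `g325c` (φ′-tadpole at (1.10)_{2,0}), `g325d`
(φ′-tadpole at (1.8)_{2,0}) — no external φ′-leg, two external A′-legs (`g325_legs`) and **D = −d + 2 in every d** (`g325a_deg` …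
`g325d_deg`).  Admissibility of the vertices needs n̄ ≥ 1, resp. n̄ ≥ 2 (p. 418: n̄ > 12).
-/

namespace Literature.MathematicalPhysics.QuantumFieldTheory.Balaban1983to89.B3Sect3LowestOrderGraphs

open Finset B3Prop1 B3Sect2Statements B3VertexBridge B3Cor23Concrete B3DivergentGraphs

/-! ## (3.6): the scalar self-energy graphs of lowest order -/

/-- **(3.6)** first picture p. 435 [PDF 25] (= the graph (3.8)): two vertices (1.8)_{n=1,n′=0}; the φ′-line joins the two
differentiated φ′-legs (leg 0), the A′-line joins the two A′-legs; the second φ′-leg of each vertex is external.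
[cite: Balaban1983Higgs3, (3.6) p.435] -/
def g36a (nbar : ℕ) (hn : 1 ≤ nbar) : Graph nbar where
  nV := 2
  kind _ := .v18 1 0
  adm _ := by simp [VertexKind.Admissible, hn]
  other x := match x with
    | ⟨i, .inl j⟩ => if j.val = 0 then some ⟨i.rev, .inl ⟨0, by simp [VertexKind.scalarLegs]⟩⟩ else none
    | ⟨i, .inr _⟩ => some ⟨i.rev, .inr ⟨0, by simp [VertexKind.vectorLegs]⟩⟩
  other_ne := by decide
  other_symm := by decide
  other_isLeft := by decide
  exists_line := by decide

/-- **(3.6)** second picture p. 435: the A′-tadpole at the vertex (1.10)_{n=2,n′=0} (its two A′-legs joined), both φ′-legs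
external. [cite: Balaban1983Higgs3, (3.6) p.435] -/
def g36b (nbar : ℕ) (hn : 2 ≤ nbar) : Graph nbar where
  nV := 1
  kind _ := .v110 2 0
  adm _ := by simp [VertexKind.Admissible, hn]
  other x := match x with
    | ⟨_, .inl _⟩ => none
    | ⟨i, .inr j⟩ => some ⟨i, .inr j.rev⟩
  other_ne := by decide
  other_symm := by decide
  other_isLeft := by decide
  exists_line := by decide

/-- **(3.6)** third picture p. 435: the φ′-tadpole at the vertex (1.6) (two of its four φ′-legs joined, the other two external).
[cite: Balaban1983Higgs3, (3.6) p.435] -/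
def g36c (nbar : ℕ) : Graph nbar where
  nV := 1
  kind _ := .v16
  adm _ := trivial
  other x := match x with
    | ⟨i, .inl j⟩ =>
      if j.val = 0 then some ⟨i, .inl ⟨1, by simp [VertexKind.scalarLegs]⟩⟩
      else if j.val = 1 then some ⟨i, .inl ⟨0, by simp [VertexKind.scalarLegs]⟩⟩ else none
    | ⟨_, .inr j⟩ => j.elim0
  other_ne := by decide
  other_symm := by decide
  other_isLeft := by decide
  exists_line := by decide

variable {nbar : ℕ}

/-- kernel: the three graphs (3.6) have two external φ′-legs, no external A′-leg, no Ã-leg and no differentiation on an external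
leg. [cite: Balaban1983Higgs3, (3.6) p.435] -/
theorem g36_legs (hn : 1 ≤ nbar) (hn2 : 2 ≤ nbar) :
    (numExtScalarLegs (g36a nbar hn) = 2 ∧ numExtVectorLegs (g36a nbar hn) = 0 ∧ numTildeLegs (g36a nbar hn) = 0 ∧
      numExtDiffs (g36a nbar hn) = 0) ∧
    (numExtScalarLegs (g36b nbar hn2) = 2 ∧ numExtVectorLegs (g36b nbar hn2) = 0 ∧ numTildeLegs (g36b nbar hn2) = 0 ∧
      numExtDiffs (g36b nbar hn2) = 0) ∧
    (numExtScalarLegs (g36c nbar) = 2 ∧ numExtVectorLegs (g36c nbar) = 0 ∧ numTildeLegs (g36c nbar) = 0 ∧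
      numExtDiffs (g36c nbar) = 0) :=
  ⟨⟨by rfl, by rfl, by rfl, by rfl⟩, ⟨by rfl, by rfl, by rfl, by rfl⟩, ⟨by rfl, by rfl, by rfl, by rfl⟩⟩

/-- **(3.6)** p. 435 [PDF 25], verbatim tag: *"(D = −d + 2)"* — kernel, every dimension d, first picture: D_G(v) = d + n + n′ − 1
− 2·(d−2)/2 − 1 = 1 per vertex, D = 2 − d. [cite: Balaban1983Higgs3, (3.6) p.435] -/
theorem g36a_deg (d : ℕ) (hn : 1 ≤ nbar) : (g36a nbar hn).deg d = 2 - (d : ℚ) := by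
  have a0 : (g36a nbar hn).intScalar (0 : Fin 2) = 1 := by rfl
  have a1 : (g36a nbar hn).intScalar (1 : Fin 2) = 1 := by rfl
  have b0 : (g36a nbar hn).intVector (0 : Fin 2) = 1 := by rfl
  have b1 : (g36a nbar hn).intVector (1 : Fin 2) = 1 := by rfl
  have c0 : (g36a nbar hn).intDiffs (0 : Fin 2) = 1 := by rfl
  have c1 : (g36a nbar hn).intDiffs (1 : Fin 2) = 1 := by rfl
  rw [Graph.deg_eq]
  change (∑ i : Fin 2, (g36a nbar hn).vertexDeg d i) - (d : ℚ) = _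
  rw [Fin.sum_univ_two, Graph.vertexDeg_eq, Graph.vertexDeg_eq, a0, a1, b0, b1, c0, c1]
  simp [g36a, VertexKind.etaCount, VertexKind.isAveragingVertex]
  ring

/-- **(3.6)** *"(D = −d + 2)"*, second picture: D_G(v) = d + 2 − 2 + 2·(2−d)/2 = 2, D = 2 − d. [cite: Balaban1983Higgs3, (3.6) p.435] -/
theorem g36b_deg (d : ℕ) (hn : 2 ≤ nbar) : (g36b nbar hn).deg d = 2 - (d : ℚ) := by
  have a0 : (g36b nbar hn).intScalar (0 : Fin 1) = 0 := by rfl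
  have b0 : (g36b nbar hn).intVector (0 : Fin 1) = 2 := by rfl
  have c0 : (g36b nbar hn).intDiffs (0 : Fin 1) = 0 := by rfl
  rw [Graph.deg_eq]
  change (∑ i : Fin 1, (g36b nbar hn).vertexDeg d i) - (d : ℚ) = _
  rw [Fin.sum_univ_one, Graph.vertexDeg_eq, a0, b0, c0]
  simp [g36b, VertexKind.etaCount, VertexKind.isAveragingVertex]
  ring

/-- **(3.6)** *"(D = −d + 2)"*, third picture: D_G(v) = d + 2·(2−d)/2 = 2, D = 2 − d. [cite: Balaban1983Higgs3, (3.6) p.435] -/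
theorem g36c_deg (d : ℕ) : (g36c nbar).deg d = 2 - (d : ℚ) := by
  have a0 : (g36c nbar).intScalar (0 : Fin 1) = 2 := by rfl
  have b0 : (g36c nbar).intVector (0 : Fin 1) = 0 := by rfl
  have c0 : (g36c nbar).intDiffs (0 : Fin 1) = 0 := by rfl
  rw [Graph.deg_eq]
  change (∑ i : Fin 1, (g36c nbar).vertexDeg d i) - (d : ℚ) = _
  rw [Fin.sum_univ_one, Graph.vertexDeg_eq, a0, b0, c0]
  simp [g36c, VertexKind.etaCount, VertexKind.isAveragingVertex]
  ring

/-! ## (3.21): two external scalar legs, one of them differentiated -/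

/-- **(3.21)** first picture p. 438 [PDF 28]: the A′-tadpole at the vertex (1.8)_{n=2,n′=0}, both φ′-legs external — the
differentiated one included. [cite: Balaban1983Higgs3, (3.21) p.438] -/
def g321a (nbar : ℕ) (hn : 2 ≤ nbar) : Graph nbar where
  nV := 1
  kind _ := .v18 2 0
  adm _ := by simp [VertexKind.Admissible, hn]
  other x := match x with
    | ⟨_, .inl _⟩ => none
    | ⟨i, .inr j⟩ => some ⟨i, .inr j.rev⟩
  other_ne := by decide
  other_symm := by decide
  other_isLeft := by decide
  exists_line := by decide

/-- **(3.21)** second picture p. 438: two vertices (1.8)_{1,0} joined by the A′-line and by ONE φ′-line from the differentiated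
leg (leg 0) of the first vertex to the undifferentiated leg (leg 1) of the second; external: the undifferentiated leg of the first
vertex and the differentiated leg of the second. [cite: Balaban1983Higgs3, (3.21) p.438] -/
def g321b (nbar : ℕ) (hn : 1 ≤ nbar) : Graph nbar where
  nV := 2
  kind _ := .v18 1 0
  adm _ := by simp [VertexKind.Admissible, hn]
  other x := match x with
    | ⟨i, .inl j⟩ =>
      if i.val = 0 ∧ j.val = 0 then some ⟨1, .inl ⟨1, by simp [VertexKind.scalarLegs]⟩⟩
      else if i.val = 1 ∧ j.val = 1 then some ⟨0, .inl ⟨0, by simp [VertexKind.scalarLegs]⟩⟩ else none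
    | ⟨i, .inr _⟩ => some ⟨i.rev, .inr ⟨0, by simp [VertexKind.vectorLegs]⟩⟩
  other_ne := by decide
  other_symm := by decide
  other_isLeft := by decide
  exists_line := by decide

/-- NOT drawn in (3.21): two vertices (1.8)_{1,0} joined by the A′-line, the φ′-legs of the first vertex joined to each other (a
φ′-tadpole through its differentiated leg), both φ′-legs of the second vertex external (one of them differentiated) — a third
graph of the model with two external φ′-legs, one differentiated, and D = 0 in d = 3 (`g321Y_deg`); its closed scalar loop
carries one power of q (cf. p. 434, p. 442 on (2.21a)). [cite: Balaban1983Higgs3, (3.21) p.438] -/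
def g321Y (nbar : ℕ) (hn : 1 ≤ nbar) : Graph nbar where
  nV := 2
  kind _ := .v18 1 0
  adm _ := by simp [VertexKind.Admissible, hn]
  other x := match x with
    | ⟨i, .inl j⟩ => if i.val = 0 then some ⟨i, .inl ⟨1 - j.val, by simp [VertexKind.scalarLegs]⟩⟩ else none
    | ⟨i, .inr _⟩ => some ⟨i.rev, .inr ⟨0, by simp [VertexKind.vectorLegs]⟩⟩
  other_ne := by decide
  other_symm := by decide
  other_isLeft := by decide
  exists_line := by decide

/-- kernel: the three graphs have two external φ′-legs, no external A′-leg, no Ã-leg, and exactly one differentiation acting on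
an external leg. [cite: Balaban1983Higgs3, (3.21) p.438] -/
theorem g321_legs (hn : 1 ≤ nbar) (hn2 : 2 ≤ nbar) :
    (numExtScalarLegs (g321a nbar hn2) = 2 ∧ numExtVectorLegs (g321a nbar hn2) = 0 ∧ numTildeLegs (g321a nbar hn2) = 0 ∧
      numExtDiffs (g321a nbar hn2) = 1) ∧
    (numExtScalarLegs (g321b nbar hn) = 2 ∧ numExtVectorLegs (g321b nbar hn) = 0 ∧ numTildeLegs (g321b nbar hn) = 0 ∧
      numExtDiffs (g321b nbar hn) = 1) ∧
    (numExtScalarLegs (g321Y nbar hn) = 2 ∧ numExtVectorLegs (g321Y nbar hn) = 0 ∧ numTildeLegs (g321Y nbar hn) = 0 ∧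
      numExtDiffs (g321Y nbar hn) = 1) :=
  ⟨⟨by rfl, by rfl, by rfl, by rfl⟩, ⟨by rfl, by rfl, by rfl, by rfl⟩, ⟨by rfl, by rfl, by rfl, by rfl⟩⟩

/-- kernel: D((3.21) first picture) = 3 − d (= 0 in d = 3): D_G(v) = d + 1 − 2·(d−2)/2. [cite: Balaban1983Higgs3, (3.21) p.438] -/
theorem g321a_deg (d : ℕ) (hn : 2 ≤ nbar) : (g321a nbar hn).deg d = 3 - (d : ℚ) := by
  have a0 : (g321a nbar hn).intScalar (0 : Fin 1) = 0 := by rfl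
  have b0 : (g321a nbar hn).intVector (0 : Fin 1) = 2 := by rfl
  have c0 : (g321a nbar hn).intDiffs (0 : Fin 1) = 0 := by rfl
  rw [Graph.deg_eq]
  change (∑ i : Fin 1, (g321a nbar hn).vertexDeg d i) - (d : ℚ) = _
  rw [Fin.sum_univ_one, Graph.vertexDeg_eq, a0, b0, c0]
  simp [g321a, VertexKind.etaCount, VertexKind.isAveragingVertex]
  ring

/-- kernel: D((3.21) second picture) = 3 − d (= 0 in d = 3). [cite: Balaban1983Higgs3, (3.21) p.438] -/
theorem g321b_deg (d : ℕ) (hn : 1 ≤ nbar) : (g321b nbar hn).deg d = 3 - (d : ℚ) := by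
  have a0 : (g321b nbar hn).intScalar (0 : Fin 2) = 1 := by rfl
  have a1 : (g321b nbar hn).intScalar (1 : Fin 2) = 1 := by rfl
  have b0 : (g321b nbar hn).intVector (0 : Fin 2) = 1 := by rfl
  have b1 : (g321b nbar hn).intVector (1 : Fin 2) = 1 := by rfl
  have c0 : (g321b nbar hn).intDiffs (0 : Fin 2) = 1 := by rfl
  have c1 : (g321b nbar hn).intDiffs (1 : Fin 2) = 0 := by rfl
  rw [Graph.deg_eq]
  change (∑ i : Fin 2, (g321b nbar hn).vertexDeg d i) - (d : ℚ) = _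
  rw [Fin.sum_univ_two, Graph.vertexDeg_eq, Graph.vertexDeg_eq, a0, a1, b0, b1, c0, c1]
  simp [g321b, VertexKind.etaCount, VertexKind.isAveragingVertex]
  ring

/-- kernel: the undrawn third graph has the same degree D = 3 − d (= 0 in d = 3). [cite: Balaban1983Higgs3, (3.21) p.438] -/
theorem g321Y_deg (d : ℕ) (hn : 1 ≤ nbar) : (g321Y nbar hn).deg d = 3 - (d : ℚ) := by
  have a0 : (g321Y nbar hn).intScalar (0 : Fin 2) = 2 := by rfl
  have a1 : (g321Y nbar hn).intScalar (1 : Fin 2) = 0 := by rfl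
  have b0 : (g321Y nbar hn).intVector (0 : Fin 2) = 1 := by rfl
  have b1 : (g321Y nbar hn).intVector (1 : Fin 2) = 1 := by rfl
  have c0 : (g321Y nbar hn).intDiffs (0 : Fin 2) = 1 := by rfl
  have c1 : (g321Y nbar hn).intDiffs (1 : Fin 2) = 0 := by rfl
  rw [Graph.deg_eq]
  change (∑ i : Fin 2, (g321Y nbar hn).vertexDeg d i) - (d : ℚ) = _
  rw [Fin.sum_univ_two, Graph.vertexDeg_eq, Graph.vertexDeg_eq, a0, a1, b0, b1, c0, c1]
  simp [g321Y, VertexKind.etaCount, VertexKind.isAveragingVertex]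
  ring

/-! ## (3.25): the vector self-energy graphs of lowest order -/

/-- **(3.25)** first picture p. 439 [PDF 29]: two vertices (1.8)_{1,0} joined by two φ′-lines, each carrying one differentiation
(leg 0 of one vertex to leg 1 of the other); the two A′-legs external. [cite: Balaban1983Higgs3, (3.25) p.439] -/
def g325a (nbar : ℕ) (hn : 1 ≤ nbar) : Graph nbar where
  nV := 2
  kind _ := .v18 1 0
  adm _ := by simp [VertexKind.Admissible, hn]
  other x := match x with
    | ⟨i, .inl j⟩ => some ⟨i.rev, .inl ⟨1 - j.val, by simp [VertexKind.scalarLegs]⟩⟩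
    | ⟨_, .inr _⟩ => none
  other_ne := by decide
  other_symm := by decide
  other_isLeft := by decide
  exists_line := by decide

/-- **(3.25)** second picture p. 439: two vertices (1.8)_{1,0} joined by two φ′-lines, one of them carrying both differentiations
(leg 0 to leg 0, leg 1 to leg 1); the two A′-legs external. [cite: Balaban1983Higgs3, (3.25) p.439] -/
def g325b (nbar : ℕ) (hn : 1 ≤ nbar) : Graph nbar where
  nV := 2
  kind _ := .v18 1 0
  adm _ := by simp [VertexKind.Admissible, hn]
  other x := match x with
    | ⟨i, .inl j⟩ => some ⟨i.rev, .inl j⟩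
    | ⟨_, .inr _⟩ => none
  other_ne := by decide
  other_symm := by decide
  other_isLeft := by decide
  exists_line := by decide

/-- **(3.25)** third picture p. 439: the φ′-tadpole at the vertex (1.10)_{2,0}, its two A′-legs external.
[cite: Balaban1983Higgs3, (3.25) p.439] -/
def g325c (nbar : ℕ) (hn : 2 ≤ nbar) : Graph nbar where
  nV := 1
  kind _ := .v110 2 0
  adm _ := by simp [VertexKind.Admissible, hn]
  other x := match x with
    | ⟨i, .inl j⟩ => some ⟨i, .inl j.rev⟩
    | ⟨_, .inr _⟩ => none
  other_ne := by decide
  other_symm := by decide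
  other_isLeft := by decide
  exists_line := by decide

/-- **(3.25)** fourth picture p. 439: the φ′-tadpole at the vertex (1.8)_{2,0} (through its differentiated leg), its two A′-legs
external. [cite: Balaban1983Higgs3, (3.25) p.439] -/
def g325d (nbar : ℕ) (hn : 2 ≤ nbar) : Graph nbar where
  nV := 1
  kind _ := .v18 2 0
  adm _ := by simp [VertexKind.Admissible, hn]
  other x := match x with
    | ⟨i, .inl j⟩ => some ⟨i, .inl j.rev⟩
    | ⟨_, .inr _⟩ => none
  other_ne := by decide
  other_symm := by decide
  other_isLeft := by decide
  exists_line := by decide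

/-- kernel: the four graphs (3.25) have no external φ′-leg, two external A′-legs, no Ã-leg and no differentiation on an external
leg. [cite: Balaban1983Higgs3, (3.25) p.439] -/
theorem g325_legs (hn : 1 ≤ nbar) (hn2 : 2 ≤ nbar) :
    (numExtScalarLegs (g325a nbar hn) = 0 ∧ numExtVectorLegs (g325a nbar hn) = 2 ∧ numTildeLegs (g325a nbar hn) = 0 ∧
      numExtDiffs (g325a nbar hn) = 0) ∧
    (numExtScalarLegs (g325b nbar hn) = 0 ∧ numExtVectorLegs (g325b nbar hn) = 2 ∧ numTildeLegs (g325b nbar hn) = 0 ∧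
      numExtDiffs (g325b nbar hn) = 0) ∧
    (numExtScalarLegs (g325c nbar hn2) = 0 ∧ numExtVectorLegs (g325c nbar hn2) = 2 ∧ numTildeLegs (g325c nbar hn2) = 0 ∧
      numExtDiffs (g325c nbar hn2) = 0) ∧
    (numExtScalarLegs (g325d nbar hn2) = 0 ∧ numExtVectorLegs (g325d nbar hn2) = 2 ∧ numTildeLegs (g325d nbar hn2) = 0 ∧
      numExtDiffs (g325d nbar hn2) = 0) :=
  ⟨⟨by rfl, by rfl, by rfl, by rfl⟩, ⟨by rfl, by rfl, by rfl, by rfl⟩, ⟨by rfl, by rfl, by rfl, by rfl⟩,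
    ⟨by rfl, by rfl, by rfl, by rfl⟩⟩

/-- **(3.25)** p. 439 [PDF 29], verbatim tag: *"(D = −d + 2)"* — kernel, every dimension d, first picture (D_G(v) = d − 2·(d−2)/2
− 1 = 1 per vertex). [cite: Balaban1983Higgs3, (3.25) p.439] -/
theorem g325a_deg (d : ℕ) (hn : 1 ≤ nbar) : (g325a nbar hn).deg d = 2 - (d : ℚ) := by
  have a0 : (g325a nbar hn).intScalar (0 : Fin 2) = 2 := by rfl
  have a1 : (g325a nbar hn).intScalar (1 : Fin 2) = 2 := by rfl
  have b0 : (g325a nbar hn).intVector (0 : Fin 2) = 0 := by rfl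
  have b1 : (g325a nbar hn).intVector (1 : Fin 2) = 0 := by rfl
  have c0 : (g325a nbar hn).intDiffs (0 : Fin 2) = 1 := by rfl
  have c1 : (g325a nbar hn).intDiffs (1 : Fin 2) = 1 := by rfl
  rw [Graph.deg_eq]
  change (∑ i : Fin 2, (g325a nbar hn).vertexDeg d i) - (d : ℚ) = _
  rw [Fin.sum_univ_two, Graph.vertexDeg_eq, Graph.vertexDeg_eq, a0, a1, b0, b1, c0, c1]
  simp [g325a, VertexKind.etaCount, VertexKind.isAveragingVertex]
  ring

/-- **(3.25)** *"(D = −d + 2)"*, second picture. [cite: Balaban1983Higgs3, (3.25) p.439] -/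
theorem g325b_deg (d : ℕ) (hn : 1 ≤ nbar) : (g325b nbar hn).deg d = 2 - (d : ℚ) := by
  have a0 : (g325b nbar hn).intScalar (0 : Fin 2) = 2 := by rfl
  have a1 : (g325b nbar hn).intScalar (1 : Fin 2) = 2 := by rfl
  have b0 : (g325b nbar hn).intVector (0 : Fin 2) = 0 := by rfl
  have b1 : (g325b nbar hn).intVector (1 : Fin 2) = 0 := by rfl
  have c0 : (g325b nbar hn).intDiffs (0 : Fin 2) = 1 := by rfl
  have c1 : (g325b nbar hn).intDiffs (1 : Fin 2) = 1 := by rfl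
  rw [Graph.deg_eq]
  change (∑ i : Fin 2, (g325b nbar hn).vertexDeg d i) - (d : ℚ) = _
  rw [Fin.sum_univ_two, Graph.vertexDeg_eq, Graph.vertexDeg_eq, a0, a1, b0, b1, c0, c1]
  simp [g325b, VertexKind.etaCount, VertexKind.isAveragingVertex]
  ring

/-- **(3.25)** *"(D = −d + 2)"*, third picture (D_G(v) = d + 2 − 2 + 2·(2−d)/2 = 2). [cite: Balaban1983Higgs3, (3.25) p.439] -/
theorem g325c_deg (d : ℕ) (hn : 2 ≤ nbar) : (g325c nbar hn).deg d = 2 - (d : ℚ) := by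
  have a0 : (g325c nbar hn).intScalar (0 : Fin 1) = 2 := by rfl
  have b0 : (g325c nbar hn).intVector (0 : Fin 1) = 0 := by rfl
  have c0 : (g325c nbar hn).intDiffs (0 : Fin 1) = 0 := by rfl
  rw [Graph.deg_eq]
  change (∑ i : Fin 1, (g325c nbar hn).vertexDeg d i) - (d : ℚ) = _
  rw [Fin.sum_univ_one, Graph.vertexDeg_eq, a0, b0, c0]
  simp [g325c, VertexKind.etaCount, VertexKind.isAveragingVertex]
  ring

/-- **(3.25)** *"(D = −d + 2)"*, fourth picture (D_G(v) = d + 2 − 1 + 2·(2−d)/2 − 1 = 2). [cite: Balaban1983Higgs3, (3.25) p.439] -/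
theorem g325d_deg (d : ℕ) (hn : 2 ≤ nbar) : (g325d nbar hn).deg d = 2 - (d : ℚ) := by
  have a0 : (g325d nbar hn).intScalar (0 : Fin 1) = 2 := by rfl
  have b0 : (g325d nbar hn).intVector (0 : Fin 1) = 0 := by rfl
  have c0 : (g325d nbar hn).intDiffs (0 : Fin 1) = 1 := by rfl
  rw [Graph.deg_eq]
  change (∑ i : Fin 1, (g325d nbar hn).vertexDeg d i) - (d : ℚ) = _
  rw [Fin.sum_univ_one, Graph.vertexDeg_eq, a0, b0, c0]
  simp [g325d, VertexKind.etaCount, VertexKind.isAveragingVertex]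
  ring

end Literature.MathematicalPhysics.QuantumFieldTheory.Balaban1983to89.B3Sect3LowestOrderGraphs
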